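import Literature.AlgebraicGeometry.Frobenioids.CosetBaseEquivalenceObjects
import HarnessLib

/-!
# An isomorphism of functors between small coset categories forces the induced group maps to differ by an inner
# automorphism (the induced `Π₁ ⥲ Π₂` of an equivalence is well defined up to `Inn(Π₂)`)

Mochizuki, *The geometry of Frobenioids II*, Kyushu J. Math. **62** (2008), §2, proof of Theorem 2.4 (ii), author's
text p. 21 [cite: MochizukiFrdII2008, Thm 2.4 (ii) p.21]: "`Ψ` induces a pair of compatible isomorphisms `G₁ ⥲ G₂`;
`K̄₁^× ⥲ K̄₂^×` — where this pair is well-defined up to composition with automorphisms of the pair `(G₂, K̄₂^×)`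
induced by elements of `G₂`"; Mochizuki, *Semi-graphs of anabelioids*, Publ. RIMS **42** (2006), Rmk. 3.2.1 p. 35
[cite: MochizukiSemiAnbd2006, Rmk 3.2.1 p.35] (the tempered fundamental group is recovered from the temperoid up to inner
automorphism); consumed by Mochizuki, *Inter-universal Teichmüller theory I*, proof of Cor. 5.3 (iv) [the
`Ker(Aut(ℱ_v) → Aut(𝒟_v))` injectivity step], p. 144 l. 41–42 [cite: Mochizuki2012, I Cor 5.3 (iv) p.144] ("we suppose
[without loss of generality] that `α` lies over the identity self-equivalence of `𝒟_v`"; the cell's hub-row label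
«C53ii/N2» below names the [IUTchI] Cor. 5.3 (ii) sub-DAG row this file serves, not the print item quoted).

PROOF-ONLY sequel (cell abc-iut, [IUTchI] Cor. 5.3 (ii) hub row «C53ii/N2 COSETCAT-SELFEQUIV-INN» of abc-iut-L5-t4's
`SUBDAG-IUTchI-Cor53.md` §R; part 1 of 2, part 2 = `CosetBaseEquivalenceInner.lean`) to abc-iut-L1's
`PadicFrobenioidPairIso.lean` (`BaseGaloisSystem.exists_mulEquiv_compatible_of_cosetCat_equivalence`: an equivalence
`E : CosetCat Π₁ ≌ CosetCat Π₂` yields a straightening `ι : (Π₁/N_k)_k ⋙ E ≅ (Π₂/N₂,k)_k` and `φ : Π₁ ≃* Π₂` with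
`r_{φ g} ≫ ι_k = ι_k ≫ E(r_g)`) and to `CosetBaseEquivalenceObjects.lean`.  Throughout, a *levelwise straightening* of a
functor `F : CosetCat Π₁ ⥤ CosetCat Π₂` along towers `(N_k)`, `(N₂,k)` is a family `j_k : Π₂/N₂,k ≅ F(Π₁/N_k)` natural
along the projections, and a *group map* for it is `φ : Π₁ → Π₂` with `r_{φ g} ≫ j_k = j_k ≫ F(r_g)` (both displayed as
hypotheses, never bundled into a definition):

* §0 small-coset-category lemmas: descent of a morphism along another one (`exists_desc_of_smul_pt`), `Π/A ≅ Π/B ⇒ A = B`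
  for open normal `A`, `B` (`eq_of_iso_cQ`), maps out of a Galois object form a torsor under right translations
  (`exists_eq_crightMul_comp`);
* §1 `exists_levelwise_of_compatible(_equivalence)`: the straightening `ι` of
  `exists_mulEquiv_compatible_of_cosetCat_equivalence` with its `Aut`-valued compatibility yields a levelwise
  straightening with group map `φ`; `apply_mem_iff_mem_of_levelwise`: `φ(N_k) = N₂,k` when `F` is faithful;
* §2 **`F ≅ F'` ⇒ `φ' = Inn(h⁻¹) ∘ φ`** (`exists_conj_of_iso`): for FUNCTORS `F, F'` (`Π₂` tempered) with levelwise
  straightenings and group maps `φ`, `φ'`, an isomorphism `F ≅ F'` forces `φ' g = h⁻¹ φ(g) h` for one `h ∈ Π₂` — the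
  composite `Π₂/N₂,k ≅ F(Π₁/N_k) ≅ F'(Π₁/N_k) ≅ Π₂/N₂,k` is an automorphism of the Galois pro-system, i.e.
  (`toAutCoset_surjective`, "complete") a right translation `r_h`; in particular
  (`exists_conj_of_compatible_of_compatible`) **the `φ` induced by ONE equivalence is well defined up to an inner
  automorphism of `Π₂`** — the printed clause.
The converse («`φ' = Inn ∘ φ` ⇒ `F ≅ F'`») and the `↔` packaging for equivalences are part 2.  Theorems only (no
definitions, no instances); pure category / topological-group theory over landed files; nothing of the disputed series is
asserted and nothing here bears on [IUTchIII] Cor. 3.12.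
-/

noncomputable section

namespace Literature.AlgebraicGeometry.Frobenioids

open CategoryTheory Opposite Topology Filter
open Literature.AnabelianGeometry.SemiGraphs

universe u

namespace BaseGaloisSystem

/-! ### §0 Lemmas on the small coset category -/

section CosetLemmas

variable {G : Type u} [Group G] [TopologicalSpace G]

/-- **Descent along a morphism of `Π`-sets.**  For `f : A → B` and `g : A → C` in the coset category, `g` factors
through `f` as soon as the stabiliser of the point of `f` fixes the point of `g` (then `g = f ≫ t` with
`t(x·B) := x·β⁻¹·pt g`, `pt f = β·B`). [cite: MochizukiFrdII2008, Ex 1.3 (i) p.11] -/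
theorem exists_desc_of_smul_pt {A B C : CosetCat G} (f : A ⟶ B) (g : A ⟶ C)
    (h : ∀ a : G, a • CosetCat.pt f = CosetCat.pt f → a • CosetCat.pt g = CosetCat.pt g) :
    ∃ t : B ⟶ C, f ≫ t = g := by
  obtain ⟨β, hβ⟩ := QuotientGroup.mk_surjective (CosetCat.pt f)
  have hc : ∀ u ∈ B.sg, u • β⁻¹ • CosetCat.pt g = β⁻¹ • CosetCat.pt g := by
    intro u hu
    have hfix : (β * u * β⁻¹) • CosetCat.pt f = CosetCat.pt f := by
      rw [← hβ, MulAction.Quotient.smul_coe, smul_eq_mul, inv_mul_cancel_right, QuotientGroup.eq, mul_inv_rev,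
        inv_mul_cancel_right]
      exact inv_mem hu
    have hg := h _ hfix
    calc u • β⁻¹ • CosetCat.pt g = (β⁻¹ * (β * u * β⁻¹)) • CosetCat.pt g := by
          rw [← mul_assoc, ← mul_assoc, inv_mul_cancel, one_mul, mul_smul]
      _ = β⁻¹ • CosetCat.pt g := by rw [mul_smul, hg]
  refine ⟨CosetCat.homMk (β⁻¹ • CosetCat.pt g) hc, CosetCat.hom_ext ?_⟩
  rw [CosetCat.pt_comp, ← hβ, CosetCat.homMk_toFun_coe, ← mul_smul, mul_inv_cancel, one_smul]

/-- A morphism `Π/A → Π/B` of coset spaces of open NORMAL subgroups forces `A ≤ B` (the stabiliser `A` of `1·A` fixes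
the image point `b·B`, whose stabiliser is `bBb⁻¹ = B`). [cite: MochizukiSemiAnbd2006, Rmk 3.1.3 p.34] -/
theorem le_of_hom_cQ {A B : OpenNormalSubgroup G} (f : cQ A ⟶ cQ B) : A ≤ B := by
  intro a ha
  obtain ⟨b, hb⟩ := QuotientGroup.mk_surjective (CosetCat.pt f)
  have h := CosetCat.smul_pt f (u := a) ha
  rw [← hb, MulAction.Quotient.smul_coe, smul_eq_mul, QuotientGroup.eq, mul_inv_rev] at h
  have h2 : b * (b⁻¹ * a⁻¹ * b) * b⁻¹ = a⁻¹ := by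
    rw [← mul_assoc, ← mul_assoc, mul_inv_cancel, one_mul, mul_inv_cancel_right]
  have h3 := B.isNormal'.conj_mem (b⁻¹ * a⁻¹ * b) h b
  rw [h2] at h3
  exact inv_mem_iff.mp h3

/-- **`Π/A ≅ Π/B` in the coset category forces `A = B`** for open normal `A`, `B`.
[cite: MochizukiSemiAnbd2006, Rmk 3.1.3 p.34] -/
theorem eq_of_iso_cQ {A B : OpenNormalSubgroup G} (e : cQ A ≅ cQ B) : A = B :=
  le_antisymm (le_of_hom_cQ e.hom) (le_of_hom_cQ e.inv)

/-- **Maps out of a Galois object form a torsor under right translations**: two morphisms `p, p' : Π/M → Π/H` (`M` open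
normal) satisfy `p' = r_a ≫ p` for some `a ∈ Π`. [cite: MochizukiSemiAnbd2006, Rmk 3.1.3 p.34] -/
theorem exists_eq_crightMul_comp (M : OpenNormalSubgroup G) {X : CosetCat G} (p p' : cQ M ⟶ X) :
    ∃ a : G, p' = crightMul M a ≫ p := by
  obtain ⟨g₁, h₁⟩ := QuotientGroup.mk_surjective (CosetCat.pt p)
  obtain ⟨g₂, h₂⟩ := QuotientGroup.mk_surjective (CosetCat.pt p')
  refine ⟨g₂ * g₁⁻¹, CosetCat.hom_ext ?_⟩
  rw [CosetCat.pt_comp, pt_crightMul, CosetCat.toFun_coe, ← h₁, ← h₂, MulAction.Quotient.smul_coe, smul_eq_mul,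
    inv_mul_cancel_right]

end CosetLemmas

/-! ### §1 Levelwise straightenings: from `exists_mulEquiv_compatible_of_cosetCat_equivalence`; `φ(N_k) = N₂,k` -/

section Level

variable {G : Type u} [Group G] [TopologicalSpace G] {G₂ : Type u} [Group G₂] [TopologicalSpace G₂]
  (N : ℕ → OpenNormalSubgroup G) (hN : Antitone N) (N₂ : ℕ → OpenNormalSubgroup G₂) (hN₂ : Antitone N₂)

/-- **A straightening yields a levelwise straightening with the same group map.**  For a functor `F` and
`ι : (Π₁/N_k)_k ⋙ F ≅ (Π₂/N₂,k)_k` compatible with `φ : Π₁ → Π₂` in the `Aut`-valued sense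
(`r_{φ g} = ι⁻¹ ≫ F(r_g) ≫ ι` on the pro-system), the components `j_k := ι_k : Π₂/N₂,k ≅ F(Π₁/N_k)` are natural along the
projections and satisfy `r_{φ g} ≫ j_k = j_k ≫ F(r_g)`. [cite: MochizukiFrdII2008, Thm 2.4 (ii) p.21] -/
theorem exists_levelwise_of_compatible (F : CosetCat G ⥤ CosetCat G₂)
    (ι : cosetSystem N hN ⋙ F.op ≅ cosetSystem N₂ hN₂) (φ : G → G₂)
    (hφ : ∀ g : G, toAutCoset N₂ hN₂ (φ g) = ι.conjAut (Functor.isoWhiskerRight (toAutCoset N hN g) F.op)) :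
    ∃ j : ∀ k : ℕ, cQ (N₂ k) ≅ F.obj (cQ (N k)),
      (∀ ⦃i k : ℕ⦄ (hik : i ≤ k), (j k).hom ≫ F.map (cproj (hN hik)) = cproj (hN₂ hik) ≫ (j i).hom) ∧
      ∀ (k : ℕ) (g : G), crightMul (N₂ k) (φ g) ≫ (j k).hom = (j k).hom ≫ F.map (crightMul (N k) g) := by
  let j : ∀ k : ℕ, cQ (N₂ k) ≅ F.obj (cQ (N k)) := fun k => (ι.app k).unop
  refine ⟨j, fun i k hik => ?_, fun k g => ?_⟩
  · have h := congrArg Quiver.Hom.unop (ι.hom.naturality (homOfLE hik))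
    rw [unop_comp, unop_comp] at h
    exact h
  · have h := congrArg (fun α : Aut (cosetSystem N₂ hN₂) => (α.hom.app k).unop) (hφ g)
    simp only [toAutCoset_hom_app, Iso.conjAut_hom, Iso.conj_apply, NatTrans.comp_app, unop_comp,
      Category.assoc] at h
    change crightMul (N₂ k) (φ g) = (j k).hom ≫ F.map (crightMul (N k) g) ≫ (j k).inv at h
    rw [h, Category.assoc, Category.assoc, Iso.inv_hom_id, Category.comp_id]

/-- **The output of `exists_mulEquiv_compatible_of_cosetCat_equivalence` yields a levelwise straightening** of
`E.functor` with group map `φ` (format with `(Equivalence.congrRight E.op).functor.mapIso`).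
[cite: MochizukiFrdII2008, Thm 2.4 (ii) p.21] -/
theorem exists_levelwise_of_compatible_equivalence (E : CosetCat G ≌ CosetCat G₂)
    (ι : cosetSystem N hN ⋙ E.functor.op ≅ cosetSystem N₂ hN₂) (φ : G → G₂)
    (hφ : ∀ g : G, toAutCoset N₂ hN₂ (φ g) =
      ι.conjAut ((Equivalence.congrRight (E := ℕ) E.op).functor.mapIso (toAutCoset N hN g))) :
    ∃ j : ∀ k : ℕ, cQ (N₂ k) ≅ E.functor.obj (cQ (N k)),
      (∀ ⦃i k : ℕ⦄ (hik : i ≤ k), (j k).hom ≫ E.functor.map (cproj (hN hik)) = cproj (hN₂ hik) ≫ (j i).hom) ∧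
      ∀ (k : ℕ) (g : G), crightMul (N₂ k) (φ g) ≫ (j k).hom = (j k).hom ≫ E.functor.map (crightMul (N k) g) := by
  refine exists_levelwise_of_compatible N hN N₂ hN₂ E.functor ι φ fun g => ?_
  rw [hφ g]
  rfl

/-- **`φ(N_k) = N₂,k`** for a FAITHFUL `F` with a levelwise straightening and group map `φ`: `φ g ∈ N₂,k ↔ g ∈ N_k`
(`g ∈ M ↔ r_g = 𝟙`, and `r_{φ g} ≫ j_k = j_k ≫ F(r_g)`). [cite: MochizukiFrdII2008, Thm 2.4 (ii) p.21] -/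
theorem apply_mem_iff_mem_of_levelwise {F : CosetCat G ⥤ CosetCat G₂} [F.Faithful]
    (j : ∀ k : ℕ, cQ (N₂ k) ≅ F.obj (cQ (N k))) (φ : G → G₂)
    (hφ : ∀ (k : ℕ) (g : G), crightMul (N₂ k) (φ g) ≫ (j k).hom = (j k).hom ≫ F.map (crightMul (N k) g))
    (k : ℕ) (g : G) : φ g ∈ N₂ k ↔ g ∈ N k := by
  rw [← crightMul_eq_id_iff, ← crightMul_eq_id_iff]
  constructor
  · intro h0
    have h2 := hφ k g
    rw [h0, Category.id_comp] at h2
    have h3 : F.map (crightMul (N k) g) = 𝟙 _ :=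
      (cancel_epi (j k).hom).1 (by rw [← h2, Category.comp_id])
    exact F.map_injective (by rw [h3, CategoryTheory.Functor.map_id])
  · intro h0
    have h2 := hφ k g
    rw [h0, CategoryTheory.Functor.map_id, Category.comp_id] at h2
    exact (cancel_mono (j k).hom).1 (by rw [h2, Category.id_comp])

end Level

/-! ### §2 An isomorphism of functors forces the group maps to differ by an inner automorphism -/

section IsoToInner

variable {G : Type u} [Group G] [TopologicalSpace G] {G₂ : Type u} [Group G₂] [TopologicalSpace G₂]
  (hG₂ : IsTempered G₂) (N : ℕ → OpenNormalSubgroup G) (hN : Antitone N)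

include hG₂ in
/-- **`F ≅ F'` ⇒ `φ' = Inn(h⁻¹) ∘ φ`, same tower.**  Let `F, F' : CosetCat Π₁ ⥤ CosetCat Π₂` (`Π₂` tempered) carry
levelwise straightenings `j`, `j'` onto the SAME cofinal tower `(Π₂/N₂,k)_k` with group maps `φ`, `φ'`.  If `F ≅ F'`,
then `φ' g = h⁻¹ φ(g) h` for a single `h ∈ Π₂`: the composite `Π₂/N₂,k ≅ F(Π₁/N_k) ≅ F'(Π₁/N_k) ≅ Π₂/N₂,k` is an
automorphism of the Galois pro-system, hence ("complete", `toAutCoset_surjective`) the right translation `r_h`, and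
it intertwines `r_{φ g}` with `r_{φ' g}` ("separated", `toAutCoset_injective`). [cite: MochizukiFrdII2008, Thm 2.4 (ii) p.21] -/
theorem exists_conj_of_iso_of_eq {F F' : CosetCat G ⥤ CosetCat G₂} (θ : F ≅ F')
    {N₂ : ℕ → OpenNormalSubgroup G₂} {hN₂ : Antitone N₂} (hN₂b : ∀ U ∈ 𝓝 (1 : G₂), ∃ k, (N₂ k : Set G₂) ⊆ U)
    (j : ∀ k : ℕ, cQ (N₂ k) ≅ F.obj (cQ (N k)))
    (hjp : ∀ ⦃i k : ℕ⦄ (hik : i ≤ k), (j k).hom ≫ F.map (cproj (hN hik)) = cproj (hN₂ hik) ≫ (j i).hom)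
    (φ : G → G₂)
    (hφ : ∀ (k : ℕ) (g : G), crightMul (N₂ k) (φ g) ≫ (j k).hom = (j k).hom ≫ F.map (crightMul (N k) g))
    (j' : ∀ k : ℕ, cQ (N₂ k) ≅ F'.obj (cQ (N k)))
    (hjp' : ∀ ⦃i k : ℕ⦄ (hik : i ≤ k), (j' k).hom ≫ F'.map (cproj (hN hik)) = cproj (hN₂ hik) ≫ (j' i).hom)
    (φ' : G → G₂)
    (hφ' : ∀ (k : ℕ) (g : G), crightMul (N₂ k) (φ' g) ≫ (j' k).hom = (j' k).hom ≫ F'.map (crightMul (N k) g)) :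
    ∃ h : G₂, ∀ g : G, φ' g = h⁻¹ * φ g * h := by
  let m : ∀ k : ℕ, cQ (N₂ k) ≅ cQ (N₂ k) := fun k => j k ≪≫ θ.app (cQ (N k)) ≪≫ (j' k).symm
  -- `m` intertwines `r_{φ g}` and `r_{φ' g}`
  have hm : ∀ (k : ℕ) (g : G),
      crightMul (N₂ k) (φ g) ≫ (m k).hom = (m k).hom ≫ crightMul (N₂ k) (φ' g) := by
    intro k g
    have h1 : F'.map (crightMul (N k) g) ≫ (j' k).inv = (j' k).inv ≫ crightMul (N₂ k) (φ' g) := by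
      rw [Iso.comp_inv_eq, Category.assoc, Iso.eq_inv_comp]
      exact (hφ' k g).symm
    change crightMul (N₂ k) (φ g) ≫ (j k).hom ≫ θ.hom.app (cQ (N k)) ≫ (j' k).inv =
      ((j k).hom ≫ θ.hom.app (cQ (N k)) ≫ (j' k).inv) ≫ crightMul (N₂ k) (φ' g)
    rw [← Category.assoc, hφ k g, Category.assoc, Category.assoc, Category.assoc, θ.hom.naturality_assoc, h1]
  -- `m` is natural along the projections
  have hnat : ∀ ⦃i k : ℕ⦄ (hik : i ≤ k), (m k).hom ≫ cproj (hN₂ hik) = cproj (hN₂ hik) ≫ (m i).hom := by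
    intro i k hik
    have h2' : F'.map (cproj (hN hik)) ≫ (j' i).inv = (j' k).inv ≫ cproj (hN₂ hik) := by
      rw [Iso.comp_inv_eq, Category.assoc, Iso.eq_inv_comp]
      exact hjp' hik
    change ((j k).hom ≫ θ.hom.app (cQ (N k)) ≫ (j' k).inv) ≫ cproj (hN₂ hik) =
      cproj (hN₂ hik) ≫ (j i).hom ≫ θ.hom.app (cQ (N i)) ≫ (j' i).inv
    rw [Category.assoc, Category.assoc, ← h2', ← θ.hom.naturality_assoc, ← Category.assoc, hjp hik,
      Category.assoc]
  -- hence an automorphism of the Galois pro-system, i.e. a right translation `r_h`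
  let μ : Aut (cosetSystem N₂ hN₂) := NatIso.ofComponents (fun k => (m k).op) (fun {i k} f => by
    change (cproj (hN₂ f.le)).op ≫ (m k).hom.op = (m i).hom.op ≫ (cproj (hN₂ f.le)).op
    rw [← op_comp, ← op_comp, hnat f.le])
  obtain ⟨h, hh⟩ := toAutCoset_surjective N₂ hN₂ hG₂ hN₂b μ
  have hmk : ∀ k, (m k).hom = crightMul (N₂ k) h := fun k => by
    have e := congrArg (fun α : Aut (cosetSystem N₂ hN₂) => (α.hom.app k).unop) hh
    exact (e : crightMul (N₂ k) h = (m k).hom).symm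
  refine ⟨h, fun g => ?_⟩
  have hk : ∀ k, crightMul (N₂ k) (φ g * h) = crightMul (N₂ k) (h * φ' g) := fun k => by
    rw [← crightMul_comp, ← crightMul_comp, ← hmk k]
    exact hm k g
  have heq : toAutCoset N₂ hN₂ (φ g * h) = toAutCoset N₂ hN₂ (h * φ' g) := by
    apply Iso.ext
    ext k
    change (crightMul (N₂ k) (φ g * h)).op = (crightMul (N₂ k) (h * φ' g)).op
    rw [hk k]
  have e := toAutCoset_injective N₂ hN₂ hG₂ hN₂b heq
  calc φ' g = h⁻¹ * (h * φ' g) := (inv_mul_cancel_left h (φ' g)).symm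
    _ = h⁻¹ * (φ g * h) := by rw [e]
    _ = h⁻¹ * φ g * h := (mul_assoc _ _ _).symm

include hG₂ in
/-- **`F ≅ F'` ⇒ `φ' = Inn(h⁻¹) ∘ φ`.**  Let `F, F' : CosetCat Π₁ ⥤ CosetCat Π₂` (`Π₂` tempered) carry levelwise
straightenings `j : Π₂/N₂,k ≅ F(Π₁/N_k)`, `j' : Π₂/N₂',k ≅ F'(Π₁/N_k)` (the first tower cofinal) with group maps
`φ`, `φ'`.  If `F ≅ F'` as functors, then the towers coincide and `φ' g = h⁻¹ φ(g) h` for one `h ∈ Π₂` and all `g`.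
[cite: MochizukiFrdII2008, Thm 2.4 (ii) p.21] -/
theorem exists_conj_of_iso {F F' : CosetCat G ⥤ CosetCat G₂} (θ : F ≅ F')
    {N₂ : ℕ → OpenNormalSubgroup G₂} {hN₂ : Antitone N₂} (hN₂b : ∀ U ∈ 𝓝 (1 : G₂), ∃ k, (N₂ k : Set G₂) ⊆ U)
    (j : ∀ k : ℕ, cQ (N₂ k) ≅ F.obj (cQ (N k)))
    (hjp : ∀ ⦃i k : ℕ⦄ (hik : i ≤ k), (j k).hom ≫ F.map (cproj (hN hik)) = cproj (hN₂ hik) ≫ (j i).hom)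
    (φ : G → G₂)
    (hφ : ∀ (k : ℕ) (g : G), crightMul (N₂ k) (φ g) ≫ (j k).hom = (j k).hom ≫ F.map (crightMul (N k) g))
    {N₂' : ℕ → OpenNormalSubgroup G₂} {hN₂' : Antitone N₂'}
    (j' : ∀ k : ℕ, cQ (N₂' k) ≅ F'.obj (cQ (N k)))
    (hjp' : ∀ ⦃i k : ℕ⦄ (hik : i ≤ k), (j' k).hom ≫ F'.map (cproj (hN hik)) = cproj (hN₂' hik) ≫ (j' i).hom)
    (φ' : G → G₂)
    (hφ' : ∀ (k : ℕ) (g : G), crightMul (N₂' k) (φ' g) ≫ (j' k).hom = (j' k).hom ≫ F'.map (crightMul (N k) g)) :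
    ∃ h : G₂, ∀ g : G, φ' g = h⁻¹ * φ g * h := by
  have hNN : N₂ = N₂' := funext fun k => eq_of_iso_cQ (j k ≪≫ θ.app (cQ (N k)) ≪≫ (j' k).symm)
  subst hNN
  exact exists_conj_of_iso_of_eq hG₂ N hN θ hN₂b j hjp φ hφ j' hjp' φ' hφ'

include hG₂ in
/-- **The printed "well-defined up to … elements of `G₂`".**  Two levelwise straightenings-with-group-map `(j, φ)`,
`(j', φ')` of the SAME functor `F : CosetCat Π₁ ⥤ CosetCat Π₂` (`Π₂` tempered; e.g. from two outputs of
`exists_mulEquiv_compatible_of_cosetCat_equivalence` for one equivalence) have `φ' = Inn(h⁻¹) ∘ φ` for one `h ∈ Π₂`: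
the isomorphism `Π₁ ⥲ Π₂` induced by an equivalence of bases is well defined up to inner automorphisms of `Π₂`.
[cite: MochizukiFrdII2008, Thm 2.4 (ii) p.21] -/
theorem exists_conj_of_compatible_of_compatible {F : CosetCat G ⥤ CosetCat G₂}
    {N₂ : ℕ → OpenNormalSubgroup G₂} {hN₂ : Antitone N₂} (hN₂b : ∀ U ∈ 𝓝 (1 : G₂), ∃ k, (N₂ k : Set G₂) ⊆ U)
    (j : ∀ k : ℕ, cQ (N₂ k) ≅ F.obj (cQ (N k)))
    (hjp : ∀ ⦃i k : ℕ⦄ (hik : i ≤ k), (j k).hom ≫ F.map (cproj (hN hik)) = cproj (hN₂ hik) ≫ (j i).hom)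
    (φ : G → G₂)
    (hφ : ∀ (k : ℕ) (g : G), crightMul (N₂ k) (φ g) ≫ (j k).hom = (j k).hom ≫ F.map (crightMul (N k) g))
    {N₂' : ℕ → OpenNormalSubgroup G₂} {hN₂' : Antitone N₂'}
    (j' : ∀ k : ℕ, cQ (N₂' k) ≅ F.obj (cQ (N k)))
    (hjp' : ∀ ⦃i k : ℕ⦄ (hik : i ≤ k), (j' k).hom ≫ F.map (cproj (hN hik)) = cproj (hN₂' hik) ≫ (j' i).hom)
    (φ' : G → G₂)
    (hφ' : ∀ (k : ℕ) (g : G), crightMul (N₂' k) (φ' g) ≫ (j' k).hom = (j' k).hom ≫ F.map (crightMul (N k) g)) :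
    ∃ h : G₂, ∀ g : G, φ' g = h⁻¹ * φ g * h :=
  exists_conj_of_iso hG₂ N hN (Iso.refl F) hN₂b j hjp φ hφ j' hjp' φ' hφ'

end IsoToInner

end BaseGaloisSystem

end Literature.AlgebraicGeometry.Frobenioids

end
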